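/-
Copyright (c) 2026 the pub-hodgecm-mathlib formalisation cell (harness21).  Prover seat hodgecm-mathlib-LH7-p07 (g0), Track A «(D-RAM) FOUR-FRAME» squad, helper lane on
h413 = stmt-HodgeConjecture-24833 (count-neutral).  β-BOARD v1 (sub-dealer LH4-p05 (g8)) RULING 15:31:23Z on ROADMAP-R7-TheoremC v1 (LH7-p05 (g0)): the residue-system
CONSTRUCTORS for ★ PT-3's product transversal (`A₀ = {1, c}`; `Aβ`, `Aγ` from additive ball systems through the NORM-DEPTH BRIDGE).  2026-09-04.
-/
import Literature.NumberTheory.LocalFields.WildQuadraticDatumNormSignConductor   -- ★ toolkit (`exists_nonnorm_dichotomy`, `normSign_of_isNorm∕not_isNorm`); brings ★ `exists_mul_map_eq_of_isRamifiedQuadraticDatum`, ★ `v_add_map_le_exp`, ★ `isAdicComplete_valuedInteger_of_completeSpace`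
import HarnessLib

/-!
# Crux `H413`, line LH4 «(D-RAM) FOUR-FRAME» — β-BOARD R7 «GLUE CLASSES», THEOREM C: THE RESIDUE-SYSTEM CONSTRUCTORS for ★ PT-3's product transversal `R₀ = A₀ × Aβ × Aγ` —
# the NORM-DEPTH BRIDGE `(∃ s ∈ U_E^{[k]}, sσs = a∕y) ↔ |a − y| ≤ |ϖ|^{2M}` (`k + d − 1 ≤ 2M ≤ k + d`), `Aβ∕Aγ := 1 + (additive system of a fixed ball mod 𝔭^{2M})`, `A₀ := {1, c}`

Cell `hodgecm-mathlib` (D-0151), FLOOR 0, crux item H413 = `stmt-HodgeConjecture-24833`, route `HCCMUnconditional`; squad F0∕P3c∕LH4, β-BOARD v1 row R7 (holder LH7-p05 (g0),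
`F0/P3c/LH7/LH7-p05/g0/ROADMAP-R7-TheoremC.v1.LH7p05g0.md` §4 «the residue-system constructors (A₀ = {1,c}; Aβ∕Aγ … the norm-depth bridge)»; sub-dealer ruling 15:31:23Z).
THEOREMS ONLY (no `def`, no instance, no notation, no `sorry`, default heartbeats); ★-only imports; lane `--supports stmt-HodgeConjecture-24833 --as helper`; pays NO row, states
NO law.  PURE LOCAL ARITHMETIC of a ramified quadratic datum `(σ, ϖ; d, t)` on ONE complete valued field `K` (the ★ letters of PT-3 `productTransversal_glued_rep`: `hA₀sub∕hA₀`,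
`hAβsub∕hAβ`, `hAγsub∕hAγ` VERBATIM in shape).

WHY.  ★ PT-3 takes three F-side ∃!-systems as DATA: `A₀` for `U_F ∕ N(U_E)`, `Aβ ⊆ U_F^{[n]}` for `U_F^{[n]} ∕ N(U_E^{[k]})` (`(n, k) = (ρ+2t, 2ρ+2t)`), `Aγ` likewise (`n = k = 2ρ`).
ROADMAP §2's linearisation wants `Aβ − 1` to be an ADDITIVE complete irredundant system of the fixed ball `|b| ≤ |ϖ|^n` modulo some `𝔭^{N}`; this file shows that `N = 2M` with
`k + d − 1 ≤ 2M ≤ k + d` does it, because on the fixed units `a, y` the multiplicative relation «`a∕y ∈ N(U_E^{[k]})`» IS the additive one «`|a − y| ≤ |ϖ|^{2M}`»: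
(⇒) `sσs − 1 = (s−1) + σ(s−1) + (s−1)σ(s−1)` and `Tr 𝔭_E^k ⊆ 𝔭^{2M}` for `2M ≤ k + d` (★ `v_add_map_le_exp`); (⇐) ★ `exists_mul_map_eq_of_isRamifiedQuadraticDatum` (Serre's `ψ`:
a fixed `u` with `|u − 1| ≤ |ϖ|^{2M}`, `M ≥ d`, is `sσs` with `|s − 1| ≤ |ϖ|^{2M+1−d} ≤ |ϖ|^k`).
* §1 `norm_witness_iff_v_sub_le` — the bridge.
* §2 `image_one_add_sub` ∕ **`image_one_add_existsUnique`** — for `B` a complete irredundant system of `{σb = b, |b| ≤ |ϖ|^n}` modulo `𝔭^{2M}` (`1 ≤ n`), the Finset `B.image (1 + ·)` has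
  PT-3's `hAβsub` and `hAβ` shape at `(n, k)`; instances of record: `Aβ`: `(n, k, 2M) = (ρ+2t, 2ρ+2t, 2ρ+2t+2⌊d∕2⌋)`, `Aγ`: `(2ρ, 2ρ, 2ρ+2⌊d∕2⌋)` (`mod_arith_of_record`).
* §3 **`pair_one_nonnorm`** (unit witnesses via ★ `v_eq_one_of_v_mul_map_eq_one`) — for ANY fixed non-norm unit `c`: `A₀ := {1, c}` has PT-3's `hA₀sub` and `hA₀` shape (index-two dichotomy ★ `exists_nonnorm_dichotomy`), `#A₀ = 2` and
  `Σ_{a ∈ A₀} ω(a) = 0` — the «`Σ_{A₀} ω = 0` kills the 1» step (L3b).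
HONEST LABEL.  Count-neutral arithmetic; R7 Theorem C, the (β) table, (β-BAL), T₊ stay OPEN; `HC_CM` is proved only modulo the 7 printed citations (2 remaining named inputs: hLiu418 =
`stmt-HodgeConjecture-24832`, h413 = `stmt-HodgeConjecture-24833`) until rung 0 closes.

## References
* [Serre1979] J.-P. Serre, *Local Fields*, GTM 67 (1979): Ch. V §3 Prop. 5, Cor. 2–3 pp. 85–87 (`N(U_E^{ψ(v)}) = U_F^{v}`, `ψ(v) = 2v − d + 1` beyond the break; `Tr 𝔭_E^k = 𝔭_F^{⌊(k+d)∕2⌋}`).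
* [NeukirchANT1999] J. Neukirch, *Algebraic Number Theory* (1999): Ch. V (1.2)–(1.3) (local norm index two; the unit filtration under the norm).
-/

set_option autoImplicit false

noncomputable section

namespace Summit.HodgeConjecture.HodgeConjecture.Cruxes.H413.F0P3cDyRamGlueResidueSystems

open WithZero
open scoped Valued
open Literature.NumberTheory.Automorphic.UnitaryThreeFourFrame
open Literature.NumberTheory.LocalFields.WildQuadraticDatum

variable {K : Type} [Field K] [Valued K ℤᵐ⁰] {σ : K →+* K} {ϖ : K} {d t : ℕ}

/-! ## §1  The norm-depth bridge -/

/-- **THE NORM-DEPTH BRIDGE.**  At a ramified datum on a complete `K`, for a fixed `a`, a fixed unit `y` and exponents with `2M ≤ k + d`, `k + d ≤ 2M + 1`, `d ≤ M`, `M ≤ k`: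
`(∃ s, |s − 1| ≤ |ϖ|^k ∧ sσs = a∕y) ↔ |a − y| ≤ |ϖ|^{2M}` — Serre's `N(U_E^{(ψ(v))}) = U_F^{(v)}` read in the valued field (`(⇒)` by the trace bound ★ `v_add_map_le_exp` on
`sσs − 1 = (s−1) + σ(s−1) + (s−1)σ(s−1)`; `(⇐)` by ★ `exists_mul_map_eq_of_isRamifiedQuadraticDatum`). [cite: Serre1979, Ch. V §3 Prop. 5, Cor. 2–3 pp. 85–87]
[cite: NeukirchANT1999, Ch. V (1.2)–(1.3)] -/
theorem norm_witness_iff_v_sub_le [CompleteSpace K] (hD : IsRamifiedQuadraticDatum σ ϖ d t) {k M : ℕ} (hMk : 2 * M ≤ k + d) (hkM : k + d ≤ 2 * M + 1)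
    (hdM : d ≤ M) (hMk2 : M ≤ k) {a y : K} (hσa : σ a = a) (hσy : σ y = y) (hy : Valued.v y = 1) :
    (∃ s : K, Valued.v (s - 1) ≤ Valued.v ϖ ^ k ∧ s * σ s = a / y) ↔ Valued.v (a - y) ≤ Valued.v ϖ ^ (2 * M) := by
  obtain ⟨hσ, hvσ, hϖ, hfix, hd, h1d, ht⟩ := id hD
  have hϖ1 : Valued.v ϖ ≤ 1 := by rw [hϖ, ← exp_zero]; exact exp_le_exp.2 (by norm_num)
  have hvϖ : 0 < Valued.v ϖ := by rw [hϖ]; exact exp_pos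
  have hy0 : y ≠ 0 := fun h0 => by rw [h0, map_zero] at hy; exact zero_ne_one hy
  -- `a − y = y·(a∕y − 1)` and `|y| = 1`
  have hay : Valued.v (a - y) = Valued.v (a / y - 1) := by
    rw [show a - y = y * (a / y - 1) by field_simp, map_mul, hy, one_mul]
  constructor
  · rintro ⟨s, hs, hsu⟩
    rw [hay, ← hsu]
    -- `sσs − 1 = (s−1) + σ(s−1) + (s−1)σ(s−1)`
    have e : s * σ s - 1 = ((s - 1) + σ (s - 1)) + (s - 1) * σ (s - 1) := by rw [map_sub, map_one]; ring
    rw [e]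
    refine (Valuation.map_add _ _ _).trans (max_le ?_ ?_)
    · -- the trace bound
      have hx : Valued.v (s - 1) ≤ exp (-(k : ℤ)) := by rw [← v_varpi_pow hϖ]; exact hs
      have h := v_add_map_le_exp hσ hfix hϖ hd ht (j := (k : ℤ)) (m := (M : ℤ)) hx (by exact_mod_cast hMk)
      rw [v_varpi_pow hϖ]
      exact_mod_cast h
    · rw [map_mul, hvσ]
      calc Valued.v (s - 1) * Valued.v (s - 1) ≤ Valued.v ϖ ^ k * Valued.v ϖ ^ k := mul_le_mul' hs hs
        _ = Valued.v ϖ ^ (k + k) := (pow_add _ _ _).symm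
        _ ≤ Valued.v ϖ ^ (2 * M) := pow_le_pow_right_of_le_one' hϖ1 (by omega)
  · intro h
    haveI := Literature.NumberTheory.LocalFields.isAdicComplete_valuedInteger_of_completeSpace hϖ
    have hσu : σ (a / y) = a / y := by rw [map_div₀, hσa, hσy]
    have hu : Valued.v (a / y - 1) ≤ Valued.v ϖ ^ (2 * d) := by
      rw [← hay]; exact h.trans (pow_le_pow_right_of_le_one' hϖ1 (by omega))
    obtain ⟨z, hz, hzd⟩ := exists_mul_map_eq_of_isRamifiedQuadraticDatum σ ϖ d t hD (a / y) hσu hu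
    refine ⟨z, ?_, hz⟩
    -- `|z − 1|·|ϖ|^d ≤ |a∕y − 1|·|ϖ| ≤ |ϖ|^{2M+1} ≤ |ϖ|^{k+d}`
    have h2 : Valued.v (z - 1) * Valued.v ϖ ^ d ≤ Valued.v ϖ ^ k * Valued.v ϖ ^ d := by
      refine hzd.trans ?_
      rw [← hay]
      calc Valued.v (a - y) * Valued.v ϖ ≤ Valued.v ϖ ^ (2 * M) * Valued.v ϖ := mul_le_mul' h le_rfl
        _ = Valued.v ϖ ^ (2 * M + 1) := (pow_succ _ _).symm
        _ ≤ Valued.v ϖ ^ (k + d) := pow_le_pow_right_of_le_one' hϖ1 (by omega)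
        _ = Valued.v ϖ ^ k * Valued.v ϖ ^ d := pow_add _ _ _
    exact le_of_mul_le_mul_right h2 (pow_pos hvϖ _)

/-! ## §2  `Aβ`, `Aγ` from an additive system of a fixed ball -/

variable [DecidableEq K]

omit [DecidableEq K] in
/-- Ball letters: a fixed `b` with `|b| ≤ |ϖ|^n`, `1 ≤ n`, has `|1 + b| = 1`, `σ(1 + b) = 1 + b`, `|(1 + b) − 1| ≤ |ϖ|^n`. [cite: Serre1979, Ch. V §3] -/
theorem one_add_letters (hD : IsRamifiedQuadraticDatum σ ϖ d t) {n : ℕ} (hn : 1 ≤ n) {b : K} (hσb : σ b = b) (hb : Valued.v b ≤ Valued.v ϖ ^ n) :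
    σ (1 + b) = 1 + b ∧ Valued.v (1 + b) = 1 ∧ Valued.v (1 + b - 1) ≤ Valued.v ϖ ^ n := by
  obtain ⟨-, -, hϖ, -, -, -, -⟩ := id hD
  have hϖlt : Valued.v ϖ < 1 := by rw [hϖ, ← exp_zero]; exact exp_lt_exp.2 (by norm_num)
  have hb1 : Valued.v b < 1 := lt_of_le_of_lt hb (pow_lt_one₀ zero_le hϖlt (by omega))
  exact ⟨by rw [map_add, map_one, hσb], Valued.v.map_one_add_of_lt hb1, by rw [add_sub_cancel_left]; exact hb⟩

/-- **`hAβsub`∕`hAγsub` SHAPE**: every member of `B.image (1 + ·)` is fixed with `|a − 1| ≤ |ϖ|^n`. [cite: Serre1979, Ch. V §3] -/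
theorem image_one_add_sub (hD : IsRamifiedQuadraticDatum σ ϖ d t) {n : ℕ} (hn : 1 ≤ n) (B : Finset K) (hB1 : ∀ b ∈ B, σ b = b ∧ Valued.v b ≤ Valued.v ϖ ^ n) :
    ∀ a ∈ B.image (fun b => 1 + b), σ a = a ∧ Valued.v (a - 1) ≤ Valued.v ϖ ^ n := by
  intro a ha
  obtain ⟨b, hb, rfl⟩ := Finset.mem_image.1 ha
  obtain ⟨h1, -, h3⟩ := one_add_letters hD hn (hB1 b hb).1 (hB1 b hb).2
  exact ⟨h1, h3⟩

/-- **`hAβ`∕`hAγ` SHAPE — THE ∃!-SYSTEM OF `U_F^{[n]} ∕ N(U_E^{[k]})` FROM AN ADDITIVE SYSTEM OF THE BALL MODULO `𝔭^{2M}`**: if `B` is a complete irredundant system of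
`{σb = b, |b| ≤ |ϖ|^n}` modulo `𝔭^{2M}` (`1 ≤ n`) and `2M ≤ k + d`, `k + d ≤ 2M + 1`, `d ≤ M`, `M ≤ k`, then every fixed `y` with `|y − 1| ≤ |ϖ|^n` has a UNIQUE `a ∈ B.image (1 + ·)` with
`a∕y ∈ N(U_E^{[k]})` (witness `s`, `|s − 1| ≤ |ϖ|^k`, `sσs = a∕y`) — §1 turns the norm relation into `|a − y| ≤ |ϖ|^{2M}`.
[cite: Serre1979, Ch. V §3 Prop. 5, Cor. 2–3 pp. 85–87] [cite: NeukirchANT1999, Ch. V (1.2)–(1.3)] -/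
theorem image_one_add_existsUnique [CompleteSpace K] (hD : IsRamifiedQuadraticDatum σ ϖ d t) {n k M : ℕ} (hn : 1 ≤ n) (hMk : 2 * M ≤ k + d) (hkM : k + d ≤ 2 * M + 1)
    (hdM : d ≤ M) (hMk2 : M ≤ k) (B : Finset K) (hB1 : ∀ b ∈ B, σ b = b ∧ Valued.v b ≤ Valued.v ϖ ^ n)
    (hB2 : ∀ b : K, σ b = b → Valued.v b ≤ Valued.v ϖ ^ n → ∃ b' ∈ B, Valued.v (b - b') ≤ Valued.v ϖ ^ (2 * M))
    (hB3 : ∀ b ∈ B, ∀ b' ∈ B, Valued.v (b - b') ≤ Valued.v ϖ ^ (2 * M) → b = b') :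
    ∀ y : K, σ y = y → Valued.v (y - 1) ≤ Valued.v ϖ ^ n →
      ∃! a, a ∈ B.image (fun b => 1 + b) ∧ ∃ s : K, Valued.v (s - 1) ≤ Valued.v ϖ ^ k ∧ s * σ s = a / y := by
  intro y hσy hy
  -- `y = 1 + b₀` with `b₀` in the ball
  have hσb₀ : σ (y - 1) = y - 1 := by rw [map_sub, map_one, hσy]
  obtain ⟨-, hvy, -⟩ := one_add_letters hD hn hσb₀ hy
  rw [add_sub_cancel] at hvy
  obtain ⟨b, hbB, hbb⟩ := hB2 (y - 1) hσb₀ hy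
  obtain ⟨hσa, -, -⟩ := one_add_letters hD hn (hB1 b hbB).1 (hB1 b hbB).2
  refine ⟨1 + b, ⟨Finset.mem_image.2 ⟨b, hbB, rfl⟩, ?_⟩, ?_⟩
  · -- existence of the norm witness: `|(1+b) − y| = |b − (y−1)| ≤ |ϖ|^{2M}`
    refine (norm_witness_iff_v_sub_le hD hMk hkM hdM hMk2 hσa hσy hvy).2 ?_
    rw [show 1 + b - y = -((y - 1) - b) by ring, Valuation.map_neg]; exact hbb
  · rintro a' ⟨ha', hs'⟩
    obtain ⟨b', hb'B, rfl⟩ := Finset.mem_image.1 ha'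
    obtain ⟨hσa', -, -⟩ := one_add_letters hD hn (hB1 b' hb'B).1 (hB1 b' hb'B).2
    have h1 := (norm_witness_iff_v_sub_le hD hMk hkM hdM hMk2 hσa' hσy hvy).1 hs'
    have h2 : Valued.v (b' - b) ≤ Valued.v ϖ ^ (2 * M) := by
      rw [show b' - b = (1 + b' - y) + ((y - 1) - b) by ring]
      exact (Valuation.map_add _ _ _).trans (max_le h1 hbb)
    rw [hB3 b' hb'B b hbB h2]

omit [Field K] [Valued K ℤᵐ⁰] [DecidableEq K] in
/-- **THE EXPONENTS OF RECORD** satisfy §2's side conditions: `Aβ` at `(n, k, M) = (ρ+2t, 2ρ+2t, ρ+t+d∕2)` and `Aγ` at `(2ρ, 2ρ, ρ+d∕2)`, as soon as `d ≤ 2(ρ + t)` resp. `d ≤ 2ρ`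
(the glue window has `2ρ ≥ n₂ − ℓ₀ ≥ 3d − 2`). [cite: Serre1979, Ch. V §3 Prop. 5] -/
theorem mod_arith_of_record (ρ t d : ℕ) (hρ : d ≤ 2 * ρ) :
    (2 * (ρ + t + d / 2) ≤ (2 * ρ + 2 * t) + d ∧ (2 * ρ + 2 * t) + d ≤ 2 * (ρ + t + d / 2) + 1 ∧ d ≤ ρ + t + d / 2 ∧ ρ + t + d / 2 ≤ 2 * ρ + 2 * t) ∧
      (2 * (ρ + d / 2) ≤ 2 * ρ + d ∧ 2 * ρ + d ≤ 2 * (ρ + d / 2) + 1 ∧ d ≤ ρ + d / 2 ∧ ρ + d / 2 ≤ 2 * ρ) := by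
  omega

/-! ## §3  `A₀ = {1, c}` -/

/-- **`A₀ := {1, c}` FOR A FIXED NON-NORM UNIT `c`** has ★ PT-3's `hA₀sub` and `hA₀` shape, cardinality `2`, and `Σ_{a ∈ A₀} ω(a) = 0`: every fixed unit `x` has EXACTLY ONE of `1∕x`,
`c∕x` a norm (index-two dichotomy ★ `exists_nonnorm_dichotomy`: if `x` is not a norm then `c₀x` and `c₀c` are, so `c∕x = (c₀c)∕(c₀x)` is; if both were norms, `c` would be).
[cite: Serre1979, Ch. V §3 Cor. 3] [cite: NeukirchANT1999, Ch. V (1.3)] -/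
theorem pair_one_nonnorm [CompleteSpace K] [Finite 𝓀[K]] (hD : IsRamifiedQuadraticDatum σ ϖ d t) {c : K} (hσc : σ c = c) (hc1 : Valued.v c = 1)
    (hcn : ¬ ∃ z : K, z * σ z = c) :
    (∀ a ∈ ({1, c} : Finset K), σ a = a ∧ Valued.v a = 1) ∧
    (∀ x : K, σ x = x → Valued.v x = 1 → ∃! a, a ∈ ({1, c} : Finset K) ∧ ∃ e : K, Valued.v e = 1 ∧ e * σ e = a / x) ∧
    ({1, c} : Finset K).card = 2 ∧ ∑ a ∈ ({1, c} : Finset K), normSign σ a = 0 := by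
  obtain ⟨hσ, hvσ, -, -, -, -, -⟩ := id hD
  have hc0 : c ≠ 0 := fun h0 => by rw [h0, map_zero] at hc1; exact zero_ne_one hc1
  have h1c : (1 : K) ≠ c := fun h => hcn ⟨1, by rw [map_one, one_mul, h]⟩
  obtain ⟨c₀, hσc₀, hc₀n, hdich⟩ := exists_nonnorm_dichotomy hD
  refine ⟨?_, ?_, by rw [Finset.card_pair h1c], ?_⟩
  · intro a ha
    rcases Finset.mem_insert.1 ha with rfl | ha
    · exact ⟨map_one σ, map_one _⟩
    · rw [Finset.mem_singleton.1 ha]; exact ⟨hσc, hc1⟩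
  · intro x hσx hx
    have hx0 : x ≠ 0 := fun h0 => by rw [h0, map_zero] at hx; exact zero_ne_one hx
    have hvx1 : Valued.v (1 / x) = 1 := by rw [one_div, map_inv₀, hx, inv_one]
    have hvcx : Valued.v (c / x) = 1 := by rw [map_div₀, hc1, hx, div_one]
    -- not both `1∕x` and `c∕x` are norms
    have hnot : (∃ e : K, e * σ e = 1 / x) → (∃ e : K, e * σ e = c / x) → False := by
      rintro ⟨e₁, he₁⟩ ⟨e₂, he₂⟩
      have he₁0 : e₁ ≠ 0 := by
        rintro rfl; rw [zero_mul] at he₁; exact one_div_ne_zero hx0 he₁.symm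
      refine hcn ⟨e₂ / e₁, ?_⟩
      rw [map_div₀, div_mul_div_comm, he₂, he₁]
      field_simp
    rcases hdich x hσx hx0 with ⟨z, hz⟩ | ⟨z, hz⟩
    · -- `x` is a norm: `a = 1`, witness `1∕z`
      have hz0 : z ≠ 0 := by rintro rfl; rw [zero_mul] at hz; exact hx0 hz.symm
      have hw : z⁻¹ * σ z⁻¹ = 1 / x := by rw [map_inv₀, ← mul_inv, hz, one_div]
      refine ⟨1, ⟨Finset.mem_insert_self _ _, z⁻¹, v_eq_one_of_v_mul_map_eq_one hvσ (by rw [hw]; exact hvx1), hw⟩, ?_⟩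
      rintro a ⟨ha, e, -, he⟩
      rcases Finset.mem_insert.1 ha with rfl | ha
      · rfl
      · rw [Finset.mem_singleton.1 ha] at he
        exact (hnot ⟨z⁻¹, hw⟩ ⟨e, he⟩).elim
    · -- `c₀x` is a norm; then so is `c₀c` (else `c₀·c₀c`... use the dichotomy on `c`), and `c∕x = (c₀c)∕(c₀x)`
      rcases hdich c hσc hc0 with ⟨w, hw⟩ | ⟨w, hw⟩
      · exact (hcn ⟨w, hw⟩).elim
      have hz0 : z ≠ 0 := by
        rintro rfl; rw [zero_mul] at hz
        have : c₀ * x = 0 := hz.symm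
        rcases mul_eq_zero.1 this with h | h
        · exact hc₀n ⟨0, by rw [zero_mul, h]⟩
        · exact hx0 h
      have hc₀0 : c₀ ≠ 0 := fun h0 => hc₀n ⟨0, by rw [zero_mul, h0]⟩
      have hwz : (w / z) * σ (w / z) = c / x := by
        rw [map_div₀, div_mul_div_comm, hw, hz]
        field_simp
      refine ⟨c, ⟨Finset.mem_insert_of_mem (Finset.mem_singleton_self _), w / z, v_eq_one_of_v_mul_map_eq_one hvσ (by rw [hwz]; exact hvcx), hwz⟩, ?_⟩
      rintro a ⟨ha, e, -, he⟩
      rcases Finset.mem_insert.1 ha with rfl | ha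
      · exact (hnot ⟨e, he⟩ ⟨w / z, hwz⟩).elim
      · exact Finset.mem_singleton.1 ha
  · rw [Finset.sum_pair h1c, normSign_of_isNorm σ ⟨1, by rw [map_one, one_mul]⟩, normSign_of_not_isNorm σ hcn]
    norm_num

end Summit.HodgeConjecture.HodgeConjecture.Cruxes.H413.F0P3cDyRamGlueResidueSystems

end
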